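import Mathlib
import HarnessLib
import HarnessLib.Audit
import Summits.RiemannHypothesis.Statement
import Literature.NumberTheory.LFunctions.ZetaZeros
import Literature.NumberTheory.LFunctions.SuzukiWeilHilbertSpaceDefs
import Summits.RiemannHypothesis.RiemannHypothesis.Theorems.DeBrangesChainConverse
import HarnessLib.Audit.Status.Attr

/-!
Route: SuzukiV0Toeplitz

# Route SuzukiV0Toeplitz — V(0) as the Toeplitz kernel of E_ξ♯/E_ξ — separation (2) from sparse
off-line zeros via the winding count of upper zeros

D-0145 LINE (ideator rh-idea-8 g2, open-question harvest; bears_on LADDER-RH column B-P, the dbl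
cell's «candidate B-P′ rung»
V(0) ≠ {0} of RESIDUAL.md §1.5). It suffices to show X = X₂ ∧ R, an ASSIGNED conjunct split of the
tree's hypothesis-free door
`DeBrangesChain.riemannHypothesis_iff_isolatedV0 : RH ↔ WeilNormIdentityOn V(0) ∧ ZeroSeparationOn
V(0)` (Suzuki2025WeilHilbertSpace
Thm 1.3). ATTACKED conjunct X₂ = Suzuki's separation condition (2) on V(0), reached through three
items: OffLineZerosSparse (the
off-line zeros of ζ have density zero in all windows [T, T+H], H ≥ T^θ — the short-window «100 %»
hypothesis, RH-free and strictly
weaker than RH) → UpperZerosCount (an RH-free winding identity: the zeros of Lagarias' E_ξ = ξ + ξ′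
in the UPPER half-plane inside a
window are counted by the off-line zeros there) → ToeplitzSeparation (𝖥V(0) = the Toeplitz kernel
with symbol conj(E_ξ♯/E_ξ);
sparse upper zeros make the separating functions of (2) constructible by Beurling–Malliavin-type
interpolation). RESIDUAL conjunct
R = NormIdentityV0 = WeilNormIdentityOn V(0) (condition (1); declared residual, not attacked). The
printed open question this line
harvests is Suzuki's «prove or disprove V(0) ≠ {0} unconditionally … a future task»
(arXiv:2301.00421 p. 3), typed in the Sketch as the rung V0Nontrivial with its own three-item plan
(see Two-layer plan; not an item of this route at open). No summit is proved by a line; nothing here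
bears on the truth of RH.
Lean: `ToeplitzSeparation ∧ OffLineZerosSparse ∧ UpperZerosCount ∧ NormIdentityV0`

## Assembly
Pure logic plus ONE tree theorem: from OffLineZerosSparse pick θ; UpperZerosCount θ turns
window-sparseness of off-line zeros into
the strip bound and window-sparseness of upper zeros of E_ξ; ToeplitzSeparation turns that into
ZeroSeparationOn (suzukiV 0); with the
residual NormIdentityV0 the PROVED door `DeBrangesChain.riemannHypothesis_iff_isolatedV0.mpr` gives
Summit.RiemannHypothesis
(`theorem closes` in glue.lean, kernel-checked in the Sketch). The rung composition V0Nontrivial ⇐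
ToeplitzNontrivial → UpperZerosMinorityOfCritical → CriticalZerosWindows is kernel-checked in the
Sketch (`v0Nontrivial_of`) and banked for a rung line.

Rationale: WHY THIS LINE. Mechanism: by the tree's RH-free theorem `suzukiFourierL2_image_suzukiV_zero : 𝖥 ''
V(0) = modelSpaceL2 lagariasTheta` the space V(0)
is, on the boundary, the Toeplitz kernel N[Θ̄_ξ] = {F ∈ H² : Θ_ξ·conj F ∈ H²} with Θ_ξ = E_ξ♯/E_ξ;
unconditionally Θ_ξ = c·e^{iαz}·B₋/B₊
where B₊ is the Blaschke product over the zeros Z₊ of E_ξ in ℂ₊ (present iff RH fails) and B₋ over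
the conjugates of the lower zeros,
so non-triviality / richness of V(0) is exactly the statement that Z₊ is NOT a uniqueness set (resp.
is an interpolable set) for the
model space K_{B₋} (Makarov–Poltoratski arXiv:math/0702497 §1.2, Thms A–C; GarciaMashreghiRoss2016
Prop 12.23). The new, load-bearing
move is the WINDING IDENTITY (UpperZerosCount): along ℝ every bounded nodal interval of Ξ turns arg
E_ξ by exactly −π whatever the
Laguerre wiggles do, so comparing with the Hadamard product gives #Z₊ ∩ W = (N(W) − N₀(W))/2 + O(H)
= #{off-line zeros, β > ½, in W}
+ O(H) in every window W of length H — the upper zeros of E_ξ ARE the off-line zeros of ζ, counted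
RH-free. Imported areas: Toeplitz
kernels / Beurling–Malliavin theory (complex analysis, MIF programme), de Branges–Lagarias structure
functions (Lagarias2006), and
critical-line zero-density technology (Selberg1942, Levinson1974, Conrey1989 — the tree's PROVED
`levinsonConrey_inequality`). What it
does that the listed routes do not: DeBrangesSuzukiDoor / SuzukiWindowsDoor / SmoothSectorHardy work
with the screw function and the
chain E_t under RH-type positivity; none factors Θ_ξ through its upper zeros or counts them; the
negatives index (4 entries: Weil
ground-state resolvent vectors ×2, Conrey character sums, universal-factor Laplace loophole) is
untouched.

RANKED CRUXES. #2 ToeplitzSeparation (crux) — if all zeros of E_ξ lie in a horizontal strip and, for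
some θ < 1, the upper-half-plane zeros of E_ξ (with multiplicity) in every window [T, T+H], T^θ ≤ H
≤ T, number ≤ ε·H·log T for every ε > 0 and T ≥ T₀(ε), then Suzuki's separation condition (2) holds
on V(0): uniformly separating ψ ∈ V(0) exist at every zero parameter (Toeplitz-kernel interpolation
with a sparse Blaschke obstruction B₊ against the log-density model space K_{B₋}). [difficulty: XL]
(why it might fail: sparseness of Z₊ only yields an infinite-dimensional kernel; (2) needs
interpolation at ALL zero parameters with (1+δ)-power off-diagonal decay, and Beurling–Malliavin
multiplier theorems are in print only for a-regular arg Θ′ ≍ |x|^κ, not for the spiky log-density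
phase of B₋.) [arXiv:math/0702497, GarciaMashreghiRoss2016, Poltoratski2012, Lagarias2006,
Suzuki2025WeilHilbertSpace, arXiv:2301.00421]
#3 OffLineZerosSparse (crux) — the short-window «100 %» hypothesis, RH-free: for some θ ∈ (0,1) and
every ε > 0 there is T₀ such that for T ≥ T₀ and T^θ ≤ H ≤ T the nontrivial zeros of ζ OFF the
critical line with ordinates in [T, T+H] have total multiplicity ≤ ε·H·log T (a named open problem,
strictly weaker than RH; the arithmetic input of the line). [difficulty: open-problem] (why it might
fail: open since Selberg 1942 / Levinson 1974; mollifier technology is capped strictly below 100 %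
at any fixed length T^θ (Radziwill2012_thm1, BettinGonek2017 in
Literature.Barriers.RiemannHypothesis.MollifierLimitations); record 5/12 (PRZZ 2020) in long
intervals.) [Selberg1942, Levinson1974, Conrey1989, PrattRoblesZaharescuZeindler2020,
KaratsubaVoronin1992]
#4 UpperZerosCount (crux) — the winding identity, RH-free: for every θ ∈ (0,1), if the off-line
zeros of ζ are ε-sparse in all windows H ≥ T^θ then (i) all zeros of E_ξ = ξ(½ − iz) + ξ′(½ − iz)
lie in a horizontal strip |Im z| ≤ C and (ii) the upper-half-plane zeros of E_ξ are ε-sparse in the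
same windows — proved by comparing −(1/π)Δ_W arg E_ξ = N₀(W) + O(1) (each nodal interval of Ξ
contributes −π) with the Hadamard-product count π(#Z₊ − #Z₋) + αH + O(√H log T). [deps:
OffLineZerosSparse] [difficulty: L] (why it might fail: the linear phase α of Θ_ξ and the tail of
the Hadamard product must be controlled to o(H log T) uniformly for H ≥ T^θ; the zero-free
horizontal strip for E_ξ is only treated under RH in Lagarias2006 and needs an RH-free argument (Re
ξ′/ξ > 0 for Re s > 1 plus growth on the left).) [Lagarias2006, Lagarias2005, Titchmarsh1986,
Suzuki2025WeilHilbertSpace]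
#7 NormIdentityV0 (crux) — [residual — declared, NOT attacked by this line] Suzuki's norm identity
(1) on V(0): the other conjunct of the door `riemannHypothesis_iff_isolatedV0`; imported complement
of the conjunct split, counted once per summit. [difficulty: open-problem] (why it might fail: it is
an RH-strength conjunct in its own right (under RH it is Suzuki's Thm 1.3 (1); RH-free it encodes
the Weil positivity on V(0)); this route offers no mechanism for it.) [Suzuki2025WeilHilbertSpace,
arXiv:2301.00421]

TWO-LAYER PLAN. RUNG PLAN (typed in the Sketch, composition `v0Nontrivial_of` kernel-checked; NOT
filed as items at open because they are outside the cone of `closes` — to be added as `aside` items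
/ a rung line once the critic rules): V0Nontrivial (suzukiV 0 ≠ {0}, Suzuki's printed question) ⇐
ToeplitzNontrivial ((½−κ)-minority of upper zeros + (½+κ)-majority of lower zeros of E_ξ in all
windows H ≥ T^θ ⇒ V(0) ≠ {0}; Makarov–Poltoratski Thm B-type at log-density) ∘
UpperZerosMinorityOfCritical (weak winding identity) ∘ CriticalZerosWindows (Selberg 1942 /
Karatsuba: ≥ κ·H·log T distinct critical zeros in windows H ≥ T^θ — KNOWN, to be typed as a
Literature fact).
Foreseen glued splits (nothing filed now): ToeplitzSeparation ⇐ FiniteCase (finitely many upper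
zeros: finite Blaschke obstruction,
the tree's RH-case interpolation template `SuzukiWeilOrthogonalSetProofs` with a polynomial
correction) → InfiniteSparseCase →
ToeplitzSeparation; UpperZerosCount ⇐ StripBound (RH-free zero-free half-planes for E_ξ) →
WindingCount → UpperZerosCount;
OffLineZerosSparse ⇐ MollifierZeroSparsity (zeros of Conrey's V in windows) →
`levinsonConrey_inequality` (PROVED) → OffLineZerosSparse.

KILL CRITERIA. Refutation of UpperZerosCount (an RH-free identity — a refuter exhibiting a window
where upper zeros of E_ξ exceed off-line zeros by
≫ H log T, or a zero of E_ξ far from the real axis at large height) closes the route outright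
(`refuted:UpperZerosCount`): the
dictionary «upper zeros = off-line zeros» is the line. Refutation of ToeplitzSeparation as typed (a
sparse-Z₊ configuration, or a
theorem that log-density Toeplitz kernels with sparse Blaschke obstructions cannot interpolate with
power decay) forces a pivot to
the weak form ToeplitzNontrivial / the rung V0Nontrivial only (then this is a rung line, not a
summit line, and is re-filed as such).
OffLineZerosSparse refuted = RH refuted. NormIdentityV0 proved elsewhere (dbl cell) moots nothing —
it is the residual.

NOT DECOMPOSED YET. The Blaschke/BM machinery inside ToeplitzSeparation (admissible majorants for
K_{B₋} at log-density, the (1+δ)-decay bookkeeping over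
all zero parameters, the three clauses of `HasHatValue` for parameters above / on / below the real
axis), the constants C (strip) and
the O(√H log T) error in UpperZerosCount, and the choice of mollifier behind OffLineZerosSparse are
layer-2 children, filed only after
a crux closes or a prover proposes the split.

CHEAPEST FALSIFIER. LOOKUP/ANALYTIC (numerics are vacuous here: below the RH-verified height 3·10¹²
the function E_ξ has no upper zeros at all, by the
pairing argument): (a) check the local computation behind UpperZerosCount on ONE hypothetical
off-line pair ρ = ½ + b + iT, 1 − ρ̄:
E_ξ must acquire exactly one zero in ℂ₊ near the parameter, at height ≈ b²/2 for small b (done by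
hand: ζ₂ ≈ (i − r)b²/2, r = Ξ′-ratio;
a refuter re-derives it or kills the line); (b) literature: a Makarov–Poltoratski /
Mitkovski–Poltoratski theorem showing that a
Toeplitz kernel N[conj(e^{iαz} B₋/B₊)] with σ(B₋) of BM-density d and Z₊ of density 0 can be trivial
would kill ToeplitzNontrivial and
with it the mechanism (searched: none found — arXiv:math/0702497 Thm B goes the other way for
a-regular spectra).

NUMBERS. θ: Selberg 1942 windows H ≥ T^{1/2+ε}; Karatsuba 1984 H ≥ T^{27/82+ε}
(KaratsubaVoronin1992). Long-interval proportions: Selberg κ > 0,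
Levinson 1/3, Conrey 0.4088, BCY 0.4105, PRZZ 5/12 (PrattRoblesZaharescuZeindler2020 Thm 1.1); the
tree also carries 2/3 via its
formalisation of Alpöge–Furman 2026 (`two_thirds_le_criticalLineProportion`). RH verified to height
3·10¹² (PlattTrudgian2021) —
E_ξ has no upper zeros with |Re z| ≤ 1.5·10¹². Upper zeros of E_ξ always satisfy 0 < Im z ≤ ½ (Re
ξ′/ξ > 0 for Re s > 1).

DEFINITION REQUESTS. None new: V(0) = `Literature.NumberTheory.LFunctions.suzukiV 0`, E_ξ =
`lagariasE`, Θ_ξ = `lagariasTheta`, zero parameters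
`suzukiZeroParam`, `HasHatValue`, `ZeroSeparationOn`, `WeilNormIdentityOn`, `riemannZetaZeroOrder`,
`ZetaZeros.riemannZetaNontrivialZeros`
all exist. Cite facts wanted later (support CriticalZerosWindows): Selberg 1942 short-interval
theorem (Titchmarsh1986 §10.9), Karatsuba 1984.

Novelty: Searches (2026-08-28): lit search --hybrid "Toeplitz kernel zeros Beurling-Malliavin density de
Branges function Riemann xi" (8 docs; relevant: paper:arxiv-math_0203120 Burnol, book:garcia2016
model spaces, book:khavin1994 problem book); lit search "Burnol complete minimal zeros zeta" (6
local + 6 remote; doi:10.5802/jtnb.434, doi:10.1006/aima.2001.2066); lit vsearch "zeros of xi off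
the critical line uniqueness set for a model space / Toeplitz kernel" (8 docs, none relevant); lit
galaxy search --star pdf --mode bm25 "Toeplitz kernel de Branges Riemann zeta zeros uniqueness set"
(8 hits: galaxy:pdf:4760089805949649620 = Burnol again, de Branges apology/proposal
pdf:3499516175284172020, pdf:-5003221795150180680, Connes essay pdf:4318080820; nothing on Toeplitz
kernels of E_ξ); lit galaxy search "Toeplitz kernel|Beurling-Malliavin density" --star pdf (8 hits,
none on ζ); earlier this session: lit read arXiv:math/0702497 (MaPo10 §1.2, Thms A/B/C pp. 3–5),
arXiv:2301.00421 p. 3, arXiv:2209.04658, arXiv:2201.10676, GMR16 pp. 83, 211; lean search / rg over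
Literature for Selberg1942, suzukiV, lagariasTheta, modelSpaceL2 (tree:
`suzukiFourierL2_image_suzukiV_zero`, `suzukiV_zero_eq_singleton_iff`, RH-conditional
`zeroSeparationOn_suzukiV_zero_of_riemannHypothesis` only).
Nearest prior art found: [corpus:paper:arxiv-math_0203120 p.2, p.11] Burnol 2002/2004
(doi:10.5802/jtnb.434) — completeness / minimality of the system of ALL zeta zeros (with
multiplicity) in de Branges–Sonine and w  [refs: 10.5802/jtnb.434, 10.1006/aima.2001.2066, math/0702497, 2301.00421, 2209.04658, 2201.10676, paper:arxiv-math_0203120, book:garcia2016, book:khavin1994, doi:10.5802/jtnb.434, doi:10.1006/aima.2001.2066, paper:arxiv-math_0702497, paper:arxiv-2301.00421, Selberg1942]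

Barriers (technique_class: toeplitz-kernel, de-branges, zero-density, levinson): - technique_class: toeplitz-kernel, de-branges, zero-density, levinson
- Literature.Barriers.RiemannHypothesis.DeBrangesPositivity: outside — the line uses no de Branges
ordering/positivity condition (Conrey–Li 2000 kill (3.1)/(3.3)); it works with the NON-inner symbol
E_ξ♯/E_ξ and its Blaschke factorisation, which exists whether or not E_ξ is Hermite–Biehler.
- Connes–Consani inner criterion (Barriers file SemilocalCutoffInnerCriterion, a proved no-go rather
than a catalogued decl): outside — it kills arguments needing the ratio of local factors to be
INNER; here non-innerness of Θ_ξ (the factor 1/B₊) is the object measured, not assumed away.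
- Literature.Barriers.RiemannHypothesis.MollifierLimitations: it DOES cap the obvious attack on
OffLineZerosSparse (Levinson–Conrey with mollifiers of length T^θ cannot give 100 %:
Radziwill2012_thm1, BettinGonek2017_thm1/2); the bet is not on beating it — OffLineZerosSparse is
declared open-problem·named, the route's own content is the RH-free reduction (UpperZerosCount,
ToeplitzSeparation) of condition (2) to it, and the rung V0Nontrivial needs only Selberg's positive
proportion, which sits far below the cap.
- Literature.Barriers.RiemannHypothesis.BrouckeDebruyneRevesz2023_thm13: outside (Beurling
counterexamples) — UpperZerosCount and ToeplitzSeparation use the exact functional equation E_ξ♯(z)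
= E_ξ(−z), the Hadamard product of ξ and the Γ-factor asymptotics of ξ′/ξ, none of which a Beurling
generalised-prime system without functio

sub-problem: RiemannHypothesis · status: draft · opened planner-rh-idea-8-g2-0 2026-08-27T23:19:38Z · rev 0 · ledger route-RiemannHypothesis-SuzukiV0Toeplitz
GENERATED by the gate from the ledger (D-0016/17). Provers cite these decls: `theorem foo : Summit.RiemannHypothesis.RiemannHypothesis.Theses.SuzukiV0Toeplitz.<Decl> := …` in Summits/RiemannHypothesis/RiemannHypothesis/Theorems/<Name>.lean.
-/

namespace Summit.RiemannHypothesis.RiemannHypothesis.Theses.SuzukiV0Toeplitz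

open scoped BigOperators Topology Manifold Classical MeasureTheory ProbabilityTheory Matrix InnerProductSpace ComplexConjugate ContinuousMap
open Filter Set Function TopologicalSpace MeasureTheory

attribute [summit_statement] _root_.Summit.RiemannHypothesis

open Summit

/-- item stmt-RiemannHypothesis-23557 · crux · rank 2 · open · by planner
why it might fail: sparseness of Z₊ only yields an infinite-dimensional kernel; (2) needs interpolation at ALL zero parameters with (1+δ)-power off-diagonal decay, and Beurling–Malliavin multiplier theorems are in print only for a-regular arg Θ′ ≍ |x|^κ, not for the spiky log-density phase of B₋.
sources: arXiv:math/0702497, GarciaMashreghiRoss2016, Poltoratski2012, Lagarias2006, Suzuki2025WeilHilbertSpace, arXiv:2301.00421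
[crux] if all zeros of E_ξ lie in a horizontal strip and, for some θ < 1, the upper-half-plane zeros
of E_ξ (with multiplicity) in every window [T, T+H], T^θ ≤ H ≤ T, number ≤ ε·H·log T for every ε > 0
and T ≥ T₀(ε), then Suzuki's separation condition (2) holds on V(0): uniformly separating ψ ∈ V(0)
exist at every zero parameter (Toeplitz-kernel interpolation with a sparse Blaschke obstruction B₊
against the log-density model space K_{B₋}). [difficulty: XL] -/
@[route_item "route-RiemannHypothesis-SuzukiV0Toeplitz", crux]
def ToeplitzSeparation : Prop :=
  (∃ θ : ℝ, 0 < θ ∧ θ < 1 ∧ (∃ C : ℝ, ∀ w : ℂ, Literature.NumberTheory.LFunctions.lagariasE w = 0 → |w.im| ≤ C) ∧ ∀ ε : ℝ, 0 < ε → ∃ T₀ : ℝ, ∀ T H : ℝ, T₀ ≤ T → T ^ θ ≤ H → H ≤ T → ∀ S : Finset ℂ, (∀ w ∈ S, 0 < w.im ∧ T ≤ w.re ∧ w.re ≤ T + H ∧ Literature.NumberTheory.LFunctions.lagariasE w = 0) → (∑ w ∈ S, ((analyticOrderAt Literature.NumberTheory.LFunctions.lagariasE w).toNat : ℝ)) ≤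 ε * H * Real.log T) → Literature.NumberTheory.LFunctions.ZeroSeparationOn (Literature.NumberTheory.LFunctions.suzukiV 0)

/-- item stmt-RiemannHypothesis-23558 · crux · rank 3 · open · by planner
why it might fail: open since Selberg 1942 / Levinson 1974; mollifier technology is capped strictly below 100 % at any fixed length T^θ (Radziwill2012_thm1, BettinGonek2017 in Literature.Barriers.RiemannHypothesis.MollifierLimitations); record 5/12 (PRZZ 2020) in long intervals.
sources: Selberg1942, Levinson1974, Conrey1989, PrattRoblesZaharescuZeindler2020, KaratsubaVoronin1992
[crux] the short-window «100 %» hypothesis, RH-free: for some θ ∈ (0,1) and every ε > 0 there is T₀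
such that for T ≥ T₀ and T^θ ≤ H ≤ T the nontrivial zeros of ζ OFF the critical line with ordinates
in [T, T+H] have total multiplicity ≤ ε·H·log T (a named open problem, strictly weaker than RH; the
arithmetic input of the line). [difficulty: open-problem] -/
@[route_item "route-RiemannHypothesis-SuzukiV0Toeplitz", crux]
def OffLineZerosSparse : Prop :=
  ∃ θ : ℝ, 0 < θ ∧ θ < 1 ∧ ∀ ε : ℝ, 0 < ε → ∃ T₀ : ℝ, ∀ T H : ℝ, T₀ ≤ T → T ^ θ ≤ H → H ≤ T → ∀ S : Finset ℂ, (∀ ρ ∈ S, ρ ∈ Literature.NumberTheory.LFunctions.ZetaZeros.riemannZetaNontrivialZeros ∧ T ≤ ρ.im ∧ ρ.im ≤ T + H ∧ ρ.re ≠ 1 / 2) → (∑ ρ ∈ S, (Literature.NumberTheory.LFunctions.riemannZetaZeroOrder ρ : ℝ)) ≤ ε * H * Real.log T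

/-- item stmt-RiemannHypothesis-23559 · crux · rank 4 · open · by planner
why it might fail: the linear phase α of Θ_ξ and the tail of the Hadamard product must be controlled to o(H log T) uniformly for H ≥ T^θ; the zero-free horizontal strip for E_ξ is only treated under RH in Lagarias2006 and needs an RH-free argument (Re ξ′/ξ > 0 for Re s > 1 plus growth on the left).
sources: Lagarias2006, Lagarias2005, Titchmarsh1986, Suzuki2025WeilHilbertSpace
[crux] the winding identity, RH-free: for every θ ∈ (0,1), if the off-line zeros of ζ are ε-sparse
in all windows H ≥ T^θ then (i) all zeros of E_ξ = ξ(½ − iz) + ξ′(½ − iz) lie in a horizontal strip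
|Im z| ≤ C and (ii) the upper-half-plane zeros of E_ξ are ε-sparse in the same windows — proved by
comparing −(1/π)Δ_W arg E_ξ = N₀(W) + O(1) (each nodal interval of Ξ contributes −π) with the
Hadamard-product count π(#Z₊ − #Z₋) + αH + O(√H log T). [deps: OffLineZerosSparse] [difficulty: L] -/
@[route_item "route-RiemannHypothesis-SuzukiV0Toeplitz", crux]
def UpperZerosCount : Prop :=
  ∀ θ : ℝ, 0 < θ → θ < 1 → (∀ ε : ℝ, 0 < ε → ∃ T₀ : ℝ, ∀ T H : ℝ, T₀ ≤ T → T ^ θ ≤ H → H ≤ T → ∀ S : Finset ℂ, (∀ ρ ∈ S, ρ ∈ Literature.NumberTheory.LFunctions.ZetaZeros.riemannZetaNontrivialZeros ∧ T ≤ ρ.im ∧ ρ.im ≤ T + H ∧ ρ.re ≠ 1 / 2) → (∑ ρ ∈ S, (Literature.NumberTheory.LFunctions.riemannZetaZeroOrder ρ : ℝ)) ≤ ε * H * Real.log T) → ((∃ C : ℝ, ∀ w : ℂ, Literature.NumberTheory.LFunctions.lagariasE w = 0 → |w.im| ≤ C) ∧ ∀ ε : ℝ, 0 < ε → ∃ T₀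 : ℝ, ∀ T H : ℝ, T₀ ≤ T → T ^ θ ≤ H → H ≤ T → ∀ S : Finset ℂ, (∀ w ∈ S, 0 < w.im ∧ T ≤ w.re ∧ w.re ≤ T + H ∧ Literature.NumberTheory.LFunctions.lagariasE w = 0) → (∑ w ∈ S, ((analyticOrderAt Literature.NumberTheory.LFunctions.lagariasE w).toNat : ℝ)) ≤ ε * H * Real.log T)

/-- item stmt-RiemannHypothesis-23560 · crux · rank 7 · open · by planner
why it might fail: it is an RH-strength conjunct in its own right (under RH it is Suzuki's Thm 1.3 (1); RH-free it encodes the Weil positivity on V(0)); this route offers no mechanism for it.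
sources: Suzuki2025WeilHilbertSpace, arXiv:2301.00421
[crux] [residual — declared, NOT attacked by this line] Suzuki's norm identity (1) on V(0): the
other conjunct of the door `riemannHypothesis_iff_isolatedV0`; imported complement of the conjunct
split, counted once per summit. [difficulty: open-problem] -/
@[route_item "route-RiemannHypothesis-SuzukiV0Toeplitz", crux]
def NormIdentityV0 : Prop :=
  Literature.NumberTheory.LFunctions.WeilNormIdentityOn (Literature.NumberTheory.LFunctions.suzukiV 0)

/-- item stmt-RiemannHypothesis-23561 · assembly · rank 1 · closed · proved by Summit.RiemannHypothesis.RiemannHypothesis.Theorems.SuzukiV0Toeplitz.assembly_proof (prover) · by planner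
sources: Suzuki2025WeilHilbertSpace
[assembly] ToeplitzSeparation → OffLineZerosSparse → UpperZerosCount → NormIdentityV0 → RH. -/
@[route_item "route-RiemannHypothesis-SuzukiV0Toeplitz"]
def Assembly : Prop :=
  ToeplitzSeparation → OffLineZerosSparse → UpperZerosCount → NormIdentityV0 → Summit.RiemannHypothesis

-- `Assembly` holds: proved by `Summit.RiemannHypothesis.RiemannHypothesis.Theorems.SuzukiV0Toeplitz.assembly_proof` (its module imports this route file, so no `_holds` link can be stated here).

/-! D-0027 §2.1 — DECIDING THEOREM (planner-authored via `route open/edit --closes-file`; by planner-rh-idea-8-g2-0 2026-08-27T23:19:38Z):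
its hypotheses are this route's items and its conclusion the sub-problem Statement (glue_lint), and it elaborates with this file. -/

/-- The deciding theorem (D-0027 §2.1): pattern (A) conjunct split of
`riemannHypothesis_iff_isolatedV0 : RH ↔ WeilNormIdentityOn V(0) ∧ ZeroSeparationOn V(0)` (PROVED in the tree,
hypothesis-free). The route ATTACKS the separation conjunct through `ToeplitzSeparation ← UpperZerosCount ← OffLineZerosSparse`
and carries the norm-identity conjunct as the declared residual `NormIdentityV0`. Pure logic. Nothing here bears on the truth of RH. -/
@[closes "route-RiemannHypothesis-SuzukiV0Toeplitz"] theorem closes (h₂ : ToeplitzSeparation) (h₃ : OffLineZerosSparse) (h₄ : UpperZerosCount)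
    (h₇ : NormIdentityV0) : Summit.RiemannHypothesis := by
  obtain ⟨θ, hθ0, hθ1, hS⟩ := h₃
  have hU := h₄ θ hθ0 hθ1 hS
  exact Summit.RiemannHypothesis.RiemannHypothesis.Theorems.DeBrangesChain.riemannHypothesis_iff_isolatedV0.mpr
    ⟨h₇, h₂ ⟨θ, hθ0, hθ1, hU.1, hU.2⟩⟩

end Summit.RiemannHypothesis.RiemannHypothesis.Theses.SuzukiV0Toeplitz
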